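import Mathlib

/-!
# The ORBIT-GRAPH LEMMA (abstract form; MEMO-an §72.3 / PROOFS-an-72 §3.3, rung L4 of the formalisation ladder §72.7)
# (cell bsd-f2-manin, analytic lens g30; cruxes C3 `ManinPrimeToThreeAtNine` stmt-BirchSwinnertonDyer-22968 / C2 `ManinOddAtFour` stmt-…-22967)

The EXTENSION step of the q-tower law (E-an-135/137) is reduced in MEMO-an §72.3 to the CONNECTIVITY of the q-Farey graph on a denominator
fibre (E-an-140), and that connectivity to a GENERATION statement in `SL₂(ℤ[1/q])` (E-an-141) through the following abstract lemma: a group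
`Γ` acts on a vertex set preserving a symmetric edge relation; if `Γ` is generated by elements each of which moves the base vertex `v₀` to a
vertex joined to `v₀` (e.g. the stabiliser of `v₀` and one `g_y` with `g_y v₀ = y` per neighbour `y ∼ v₀`), then the whole orbit `Γ·v₀` lies in
the connected component of `v₀`.  This file proves that lemma over Mathlib (`MulAction`, `Subgroup.closure`, `Relation.ReflTransGen`):

* `reflTransGen_smul_of_mem_closure` — for `γ ∈ Subgroup.closure S`, `v₀` is joined to `γ • v₀`, provided every `g ∈ S` has `v₀` joined to `g • v₀`.
* `reflTransGen_of_closure_eq_top` — if moreover `Subgroup.closure S = ⊤` and `Γ` acts transitively on the vertices reachable… (orbit form: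
  every `γ • v₀` is joined to `v₀`), and `connected_of_closure_eq_top_of_transitive` — with a transitive action, EVERY vertex is joined to `v₀`.

The instantiation (Γ = the S-congruence group `Γ_S^{±q}(N) ⊂ SL₂(ℤ[1/q])` acting on the reduced fractions of the fibre, edges `|BD′ − B′D| = qᵉ`;
PROOFS-an-72 §3.1–3.4) is NOT done here.  HONEST FRAMING: pure group theory / combinatorics; nothing about modular symbols, Manin's conjecture
or BSD is asserted.
-/

set_option linter.dupNamespace false
set_option autoImplicit false

namespace Summit.BirchSwinnertonDyer.BirchSwinnertonDyer.Theorems.ManinLocalTwoThree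

/-- Translating a path by a group element: if `E` is `Γ`-invariant then so is its reflexive-transitive closure. -/
theorem reflTransGen_smul {Γ X : Type*} [Group Γ] [MulAction Γ X] {E : X → X → Prop}
    (hinv : ∀ (g : Γ) (x y : X), E x y → E (g • x) (g • y)) (g : Γ) {x y : X} (h : Relation.ReflTransGen E x y) :
    Relation.ReflTransGen E (g • x) (g • y) := by
  induction h with
  | refl => exact Relation.ReflTransGen.refl
  | tail _ hbc ih => exact ih.tail (hinv g _ _ hbc)

/-- Reversing a path of a symmetric relation. -/
theorem reflTransGen_reverse {X : Type*} {E : X → X → Prop} (hsymm : ∀ x y : X, E x y → E y x) {a b : X}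
    (h : Relation.ReflTransGen E a b) : Relation.ReflTransGen E b a := by
  induction h with
  | refl => exact Relation.ReflTransGen.refl
  | tail _ hbc ih => exact Relation.ReflTransGen.head (hsymm _ _ hbc) ih

/-- **ORBIT-GRAPH LEMMA (word-length induction, PROOFS-an-72 §3.3).**  `Γ` acts on `X` preserving the symmetric edge relation `E`; if every
generator `g ∈ S` moves `v₀` to a vertex joined to `v₀` by an `E`-path, then so does every `γ ∈ Subgroup.closure S`. [folklore] -/
theorem reflTransGen_smul_of_mem_closure {Γ X : Type*} [Group Γ] [MulAction Γ X] {E : X → X → Prop} (hsymm : ∀ x y : X, E x y → E y x)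
    (hinv : ∀ (g : Γ) (x y : X), E x y → E (g • x) (g • y)) (v₀ : X) {S : Set Γ}
    (hS : ∀ g ∈ S, Relation.ReflTransGen E v₀ (g • v₀)) {γ : Γ} (hγ : γ ∈ Subgroup.closure S) :
    Relation.ReflTransGen E v₀ (γ • v₀) := by
  induction hγ using Subgroup.closure_induction with
  | mem g hg => exact hS g hg
  | one => rw [one_smul]
  | mul g g' _ _ hg hg' =>
    -- `v₀ ⟶ g • v₀` and `g • (v₀ ⟶ g' • v₀) = (g • v₀ ⟶ (g g') • v₀)`
    rw [mul_smul]
    exact hg.trans (reflTransGen_smul hinv g hg')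
  | inv g _ hg =>
    -- apply `g⁻¹` to `v₀ ⟶ g • v₀` and reverse the path
    have h := reflTransGen_smul hinv g⁻¹ hg
    rw [inv_smul_smul] at h
    exact reflTransGen_reverse hsymm h

/-- If the generators `S` of the WHOLE group move `v₀` inside its component, the whole orbit `Γ • v₀` is joined to `v₀`. -/
theorem reflTransGen_smul_of_closure_eq_top {Γ X : Type*} [Group Γ] [MulAction Γ X] {E : X → X → Prop} (hsymm : ∀ x y : X, E x y → E y x)
    (hinv : ∀ (g : Γ) (x y : X), E x y → E (g • x) (g • y)) (v₀ : X) {S : Set Γ} (htop : Subgroup.closure S = ⊤)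
    (hS : ∀ g ∈ S, Relation.ReflTransGen E v₀ (g • v₀)) (γ : Γ) : Relation.ReflTransGen E v₀ (γ • v₀) :=
  reflTransGen_smul_of_mem_closure hsymm hinv v₀ hS (htop ▸ Subgroup.mem_top γ)

/-- **Connectivity from generation and transitivity** (the form used for E-an-141 ⟹ E-an-140): if `Γ` acts TRANSITIVELY on `X` preserving the
symmetric edge relation `E`, and `Γ` is generated by elements moving `v₀` inside its `E`-component, then EVERY vertex is joined to `v₀`. -/
theorem connected_of_closure_eq_top_of_transitive {Γ X : Type*} [Group Γ] [MulAction Γ X] {E : X → X → Prop} (hsymm : ∀ x y : X, E x y → E y x)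
    (hinv : ∀ (g : Γ) (x y : X), E x y → E (g • x) (g • y)) (v₀ : X) {S : Set Γ} (htop : Subgroup.closure S = ⊤)
    (hS : ∀ g ∈ S, Relation.ReflTransGen E v₀ (g • v₀)) (htrans : ∀ x : X, ∃ γ : Γ, γ • v₀ = x) (x : X) :
    Relation.ReflTransGen E v₀ x := by
  obtain ⟨γ, rfl⟩ := htrans x
  exact reflTransGen_smul_of_closure_eq_top hsymm hinv v₀ htop hS γ

/-- The generating set of PROOFS-an-72 §3.3 qualifies: stabiliser elements (`g • v₀ = v₀`) and neighbour-movers (`E v₀ (g • v₀)`) both move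
`v₀` inside its component. -/
theorem reflTransGen_of_stabilizer_or_adjacent {Γ X : Type*} [Group Γ] [MulAction Γ X] {E : X → X → Prop} (v₀ : X) {g : Γ}
    (h : g • v₀ = v₀ ∨ E v₀ (g • v₀)) : Relation.ReflTransGen E v₀ (g • v₀) := by
  rcases h with h | h
  · rw [h]
  · exact Relation.ReflTransGen.single h

end Summit.BirchSwinnertonDyer.BirchSwinnertonDyer.Theorems.ManinLocalTwoThree
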